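import Summits.AtomisticToContinuum.HydrodynamicLimit.Theorems.AntiMazurCoboundariesCorrectorPressureDecayKiferCanonicalCellTupleCore
import Summits.AtomisticToContinuum.HydrodynamicLimit.Theorems.AntiMazurCoboundariesCorrectorPressureDecayKiferCollarTrick
import Literature.MathematicalPhysics.StatisticalMechanics.SpecificRelativeEntropyProofs

/-!
# The cell-tuple law of the blown-up canonical torus law (line `FirstLemma`, crux stmt-AtomisticToContinuum-14135)

Registered stub `c9_map_cellTuple_canonicalBlowUp_eq_cond` (lead seat c9, Gibbs route of the uniform entropy bound, the
identification behind the finite-`N` cell inequality), namespace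
`Summit.AtomisticToContinuum.HydrodynamicLimit.Theorems.KiferCompactification`. The shared definitions `c9PerSqDist`
(squared periodic distance of the cube of side `S`) and `c9TorusHardCoreTuples` (the event, on tuples of cell
configurations, "total number `n` and torus hard core") are those of `…KiferCollarTrick.lean`, the cells `c9Cell` those of
`…KiferCellTranslation.lean`; this file reads the event on one configuration and on a labelled tuple
(`cellTuple_mem_c9TorusHardCoreTuples_iff`, `ofFn_count_and_forall_iff`) and proves its measurability
(`measurableSet_c9TorusHardCoreTuples`); the conditioning, Poisson and cell tools, the canonical law as a conditioned ideal
gas and the exact blow-up are in `…KiferCanonicalCellTupleCore.lean`.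

**Statement.** For constant profiles (`0 < σ ≤ 1/2`, `a, θ > 0`), `ε = ε_N = hsDiameter σ N`, `S = ε⁻¹`, a base point
`x₀` and `m ≥ 1`: the joint law of the `m³` cell restrictions of the blown-up canonical configuration
`blowUp ε x₀ z`, `z ∼ localGibbsLaw`, is the PRODUCT over the cells of the free finite-volume unit-diameter hard-sphere
measures `γ_j = gibbsSpecMeasure 1 z θ⁻¹ u₀ (cell j) ∅` (any activity `z > 0`) CONDITIONED on
`c9TorusHardCoreTuples S m (N+1)`.

**Proof** (a chain of identifications through the Poisson process; the activity drops out on conditioning on the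
number of points).
* The constant-profile canonical law is the ideal gas `(Haar ⊗ N(u₀,θ))^{⊗(N+1)}` conditioned on the torus hard core
  (`localGibbsLaw_const_eq_cond`); the blow-up of one ideal-gas particle has law `ε³ · (Leb_C ⊗ N(u₀,θ))`, `C` the
  cube of side `S` (`map_blowUpPoint_eq`), and the torus hard core of the pre-images is the periodic hard core of the
  blown-up positions (`le_euclidDist_iff_one_le_c9PerSqDist`). Hence the left side is `cfg_* (π^{⊗(N+1)}[| D])` with
  `π = Leb_C ⊗ N(u₀,θ)`, `D` the labelled periodic hard core, `cfg` = cell tuple of `{y₁,…,y_{N+1}}` (scalars drop out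
  of conditioning, `cond_smul_measure`).
* `γ_j` is the Poisson law of intensity `z π_j` conditioned on the unit hard core (`gibbsSpecMeasure_empty_eq_cond_poissonLaw`:
  the tree's bridge `hsLocalSpec_eq_gibbsSpec` and Kingman's restriction theorem), a product of conditioned laws is the
  conditioned product (`pi_cond_eq_cond_pi`), the product of the Poisson laws of the cells is the cell tuple of ONE
  Poisson law of intensity `z π` (complete independence, `map_pi_restrict_eq_pi_of_poisson`), the event forces
  `N + 1` points (`cellTuple_mem_c9TorusHardCoreTuples_iff`), and on `{N = N+1}` the Poisson law is a multiple of
  `{·}_* (zπ)^{⊗(N+1)}` (the Janossy layer, `restrict_count_eq_smul_map_ofFn_of_poisson`). Hence the right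
  side is `cfg_* (π^{⊗(N+1)}[| cfg⁻¹ E])`, and `cfg⁻¹ E = D` a.s. (`ofFn_count_and_forall_iff`).

References: S. Olla, S. R. S. Varadhan, H.-T. Yau, Comm. Math. Phys. 155 (1993) §3–4 (blow-ups of the canonical torus
gas); J. F. C. Kingman, *Poisson Processes* (1993) §2.2–2.5; G. Last, M. Penrose, *Lectures on the Poisson Process* (2017)
Prop. 3.5 (the binomial layer); D. Ruelle, *Statistical Mechanics: Rigorous Results* (1969) §1.2.1.
-/

noncomputable section

open MeasureTheory ProbabilityTheory Set Filter Topology Function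
open scoped ENNReal NNReal Pointwise

namespace Summit.AtomisticToContinuum.HydrodynamicLimit.Theorems.KiferCompactification

open Literature.MathematicalPhysics.KineticTheory (T3 V3 hsDiameter hsDiameter_pos localGibbsLaw blowUpPoint blowUp
  gaussMeasure Ov)
open Literature.MathematicalPhysics.KineticTheory.HardSphereDLR (gibbsSpecMeasure)
open Literature.MathematicalPhysics.KineticTheory.PointProcess (windowRestrict)
open Literature.MathematicalPhysics.StatisticalMechanics (ae_map_restrict_carrier_subset isFiniteMeasure_restrict_prod)
open Literature.MathematicalPhysics.StatisticalMechanics.HardSphere (window measurableSet_window mem_window poissonLaw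
  isPoissonPointProcess_poissonLaw hardCoreSet measurableSet_hardCoreSet)
open Literature.Analysis.FluidPDE (HardSphereFlow Config)
open Literature.Analysis.FunctionSpaces (PointConfig IsPoissonPointProcess)
open Literature.Analysis.FluidPDE.Torus (reprSym)

variable {S : ℝ} {m : ℕ}

/-! ## The periodic distance of blown-up points is the blown-up torus distance -/

/-- **The torus hard core is the periodic hard core of the blow-ups**: `ε ≤ dist_𝕋(a, b)` iff the blown-up positions
`ε⁻¹ reprSym (a - x₀)`, `ε⁻¹ reprSym (b - x₀)` are at squared periodic distance `≥ 1` in the cube of side `ε⁻¹`. -/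
theorem le_euclidDist_iff_one_le_c9PerSqDist {ε : ℝ} (hε : 0 < ε) (x₀ a b : T3) :
    ε ≤ Literature.Analysis.FluidPDE.Torus.euclidDist a b ↔
      1 ≤ c9PerSqDist ε⁻¹ (ε⁻¹ • reprSym (a - x₀)) (ε⁻¹ • reprSym (b - x₀)) := by
  have hi : 0 ≤ ε⁻¹ := inv_nonneg.2 hε.le
  have hD : c9PerSqDist ε⁻¹ (ε⁻¹ • reprSym (a - x₀)) (ε⁻¹ • reprSym (b - x₀)) = (∑ k, ‖a k - b k‖ ^ 2) / ε ^ 2 := by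
    rw [c9PerSqDist, Finset.sum_div]
    refine Finset.sum_congr rfl fun k _ => ?_
    rw [norm_apply_sub_eq_min a b x₀ k, PiLp.smul_apply, PiLp.smul_apply, smul_eq_mul, smul_eq_mul, ← mul_sub, abs_mul,
      abs_of_nonneg hi, ← mul_one_sub, ← mul_min_of_nonneg _ _ hi, mul_pow, inv_pow, mul_comm, div_eq_mul_inv]
  rw [hD, one_le_div (pow_pos hε 2), Literature.MathematicalPhysics.KineticTheory.euclidDist_eq_sqrt, Real.le_sqrt' hε]

/-- The squared periodic distance is at most the squared Euclidean distance (`S ≥ 0`). -/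
theorem c9PerSqDist_le_norm_sq (hS : 0 ≤ S) (y y' : V3) : c9PerSqDist S y y' ≤ ‖y - y'‖ ^ 2 := by
  rw [c9PerSqDist, EuclideanSpace.norm_sq_eq]
  refine Finset.sum_le_sum fun i _ => ?_
  rw [PiLp.sub_apply, Real.norm_eq_abs]
  exact sq_le_sq' (le_min (by linarith [abs_nonneg (y i - y' i)]) (by linarith [abs_nonneg (y i - y' i)]))
    (min_le_left _ _)

/-! ## The event through the cell tuple: on one configuration, on a labelled tuple; measurability -/

/-- **The cell-tuple event read on one configuration**: for a configuration covered by the cells, its cell tuple lies in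
`c9TorusHardCoreTuples S m n` iff it has `n` points, pairwise at periodic distance `≥ 1`. -/
theorem cellTuple_mem_c9TorusHardCoreTuples_iff (hS : 0 < S) (hm : 0 < m) (n : ℕ) {ω : PointConfig (V3 × V3)}
    (hcov : ∀ p ∈ ω, ∃ j, p.1 ∈ c9Cell S m j) :
    (fun j => ω.restrict (window (c9Cell S m j))) ∈ c9TorusHardCoreTuples S m n ↔
      ω.count univ = n ∧ ∀ p ∈ ω, ∀ q ∈ ω, p ≠ q → 1 ≤ c9PerSqDist S p.1 q.1 := by
  rw [c9TorusHardCoreTuples, mem_setOf_eq, sum_count_restrict_window_c9Cell hS hm hcov]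
  refine and_congr Iff.rfl ⟨fun h p hp q hq hpq => ?_, fun h j j' p q hp hq hjpq => ?_⟩
  · obtain ⟨j, hj⟩ := hcov p hp
    obtain ⟨j', hj'⟩ := hcov q hq
    exact h j j' p q ⟨hp, mem_window.2 hj⟩ ⟨hq, mem_window.2 hj'⟩ (Or.inr hpq)
  · refine h p hp.1 q hq.1 fun hpq => ?_
    subst hpq
    exact hjpq.elim (fun hjj' => hjj' (c9Cell_eq_of_mem hS hm (mem_window.1 hp.2) (mem_window.1 hq.2))) fun h' => h' rfl

/-- **The event read on a labelled tuple**: the configuration `{y₁, …, y_k}` has `k` points pairwise at periodic distance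
`≥ 1` iff all pairs of distinct LABELS are at periodic distance `≥ 1` (such tuples are injective: the periodic distance of
a point to itself is `0`). -/
theorem ofFn_count_and_forall_iff (hS : 0 ≤ S) {k : ℕ} (y : Fin k → V3 × V3) :
    ((PointConfig.ofFn y).count univ = k ∧
        ∀ p ∈ PointConfig.ofFn y, ∀ q ∈ PointConfig.ofFn y, p ≠ q → 1 ≤ c9PerSqDist S p.1 q.1) ↔
      ∀ i i', i ≠ i' → 1 ≤ c9PerSqDist S (y i).1 (y i').1 := by
  have hself : ∀ a : V3, ¬ (1 ≤ c9PerSqDist S a a) := fun a => by simp [c9PerSqDist, min_eq_left hS]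
  constructor
  · rintro ⟨hcount, h⟩ i i' hii'
    exact h (y i) (PointConfig.apply_mem_ofFn y i) (y i') (PointConfig.apply_mem_ofFn y i')
      ((injective_of_count_ofFn_eq hcount).ne hii')
  · intro h
    have hinj : Injective y := fun i i' hii' => by_contra fun hne => hself _ (by simpa [hii'] using h i i' hne)
    refine ⟨PointConfig.count_univ_ofFn_of_injective hinj, fun p hp q hq hpq => ?_⟩
    obtain ⟨i, rfl⟩ := PointConfig.mem_ofFn.1 hp
    obtain ⟨i', rfl⟩ := PointConfig.mem_ofFn.1 hq
    exact h i i' fun hii' => hpq (by rw [hii'])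

/-- The squared periodic distance is a measurable function of the pair of phase points. -/
theorem measurable_c9PerSqDist (S : ℝ) : Measurable fun pq : (V3 × V3) × (V3 × V3) => c9PerSqDist S pq.1.1 pq.2.1 := by
  unfold c9PerSqDist
  fun_prop

/-- **The cell-tuple event `c9TorusHardCoreTuples S m n` is measurable.** -/
theorem measurableSet_c9TorusHardCoreTuples (S : ℝ) (m n : ℕ) : MeasurableSet (c9TorusHardCoreTuples S m n) := by
  set Bad : (Fin 3 → Fin m) → (Fin 3 → Fin m) → Set ((V3 × V3) × (V3 × V3)) := fun j j' =>
    {pq | (j ≠ j' ∨ pq.1 ≠ pq.2) ∧ ¬ 1 ≤ c9PerSqDist S pq.1.1 pq.2.1} with hBad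
  have hBm : ∀ j j', MeasurableSet (Bad j j') := fun j j' =>
    ((MeasurableSet.const _).union (measurableSet_eq_fun measurable_fst measurable_snd).compl).inter
      (measurableSet_le measurable_const (measurable_c9PerSqDist S)).compl
  have hcount : Measurable fun t : (Fin 3 → Fin m) → PointConfig (V3 × V3) => ∑ j, (t j).count univ :=
    (measurable_of_countable fun v : (Fin 3 → Fin m) → ℕ∞ => ∑ j, v j).comp
      (measurable_pi_lambda _ fun j => (PointConfig.measurable_count MeasurableSet.univ).comp (measurable_pi_apply j))
  have hset : c9TorusHardCoreTuples S m n = (fun t : (Fin 3 → Fin m) → PointConfig (V3 × V3) => ∑ j, (t j).count univ) ⁻¹'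
      {(n : ℕ∞)} ∩ ⋂ j, ⋂ j', {t | ∀ p q, p ∈ t j → q ∈ t j' → (p, q) ∉ Bad j j'} := by
    ext t
    simp only [c9TorusHardCoreTuples, hBad, mem_setOf_eq, mem_inter_iff, mem_preimage, mem_singleton_iff, mem_iInter,
      not_and_not_right]
  rw [hset]
  exact (hcount (measurableSet_singleton _)).inter (MeasurableSet.iInter fun j => MeasurableSet.iInter fun j' =>
    measurableSet_forall_mem_notMem (measurable_pi_apply j) (measurable_pi_apply j') (hBm j j'))

/-! ## The registered stub -/

/-- Registered stub `c9_map_cellTuple_canonicalBlowUp_eq_cond` (line `FirstLemma`, W2-2): **the cell-tuple law of the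
blown-up canonical torus law is the product of the free cell measures conditioned on the torus hard core and the
particle number.** For `0 < σ ≤ 1/2`, `a, θ, z > 0`, `ε = hsDiameter σ N`, a base point `x₀` and `m ≥ 1`, the law of
`(windowRestrict (cell j) (blowUp ε x₀ z))_j` under `localGibbsLaw σ a u₀ θ N Φ` is
`(⊗_j gibbsSpecMeasure 1 z θ⁻¹ u₀ (cell j) ∅)[| c9TorusHardCoreTuples ε⁻¹ m (N+1)]` (see the module docstring for the
chain of identifications). -/
theorem c9_map_cellTuple_canonicalBlowUp_eq_cond (σ a θ : ℝ) (u₀ : V3) (hσ : 0 < σ) (hσ2 : σ ≤ 1 / 2) (ha : 0 < a)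
    (hθ : 0 < θ) {z : ℝ} (hz : 0 < z) (N : ℕ)
    (Φ : HardSphereFlow (Literature.Analysis.FluidPDE.Torus.geometry (Fin 3)) (hsDiameter σ N) (N + 1)) (x₀ : T3)
    {m : ℕ} (hm : 0 < m) :
    ((localGibbsLaw σ (fun _ => a) (fun _ => u₀) (fun _ => θ) N Φ).map (blowUp (hsDiameter σ N) x₀)).map
        (fun ω (j : Fin 3 → Fin m) => windowRestrict (c9Cell (hsDiameter σ N)⁻¹ m j) ω) =
      (Measure.pi fun j : Fin 3 → Fin m => gibbsSpecMeasure 1 z θ⁻¹ u₀ (c9Cell (hsDiameter σ N)⁻¹ m j) ∅)[|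
        c9TorusHardCoreTuples (hsDiameter σ N)⁻¹ m (N + 1)] := by
  classical
  have hG := localGibbsLaw_const_eq_cond hσ2 ha hθ u₀ N Φ
  have hε : 0 < hsDiameter σ N := hsDiameter_pos hσ N
  generalize hsDiameter σ N = ε at hG hε ⊢
  have hS : 0 < ε⁻¹ := inv_pos.2 hε
  -- the cells, their union, the one-particle law and the Poisson law
  set Λ : (Fin 3 → Fin m) → Set V3 := fun j => c9Cell ε⁻¹ m j with hΛdef
  have hΛm : ∀ j, MeasurableSet (Λ j) := fun j => measurableSet_c9Cell ε⁻¹ m j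
  set U : Set V3 := ⋃ j, Λ j with hUdef
  have hUm : MeasurableSet U := MeasurableSet.iUnion hΛm
  have hUb : Bornology.IsBounded U := isBounded_iUnion_c9Cell hε hm
  have hdisjW : Pairwise (Disjoint on fun j : Fin 3 → Fin m => window (Λ j)) := fun j j' hjj' =>
    Set.disjoint_left.2 fun p hp hp' => hjj' (c9Cell_eq_of_mem hS hm (mem_window.1 hp) (mem_window.1 hp'))
  set M : Measure V3 := gaussMeasure u₀ θ with hMdef
  set mU : Measure (V3 × V3) := ((volume : Measure V3).restrict U).prod M with hmUdef
  haveI : IsFiniteMeasure mU := isFiniteMeasure_restrict_prod hUb M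
  set ν : Measure (V3 × V3) := (Real.toNNReal z) • mU with hνdef
  have hν0 : ∀ x, ν {x} = 0 := fun x => by
    rw [hνdef, Measure.smul_apply, hmUdef, ← singleton_prod_singleton, Measure.prod_prod]
    simp
  set P : Measure (PointConfig (V3 × V3)) := poissonLaw ν with hPdef
  have hP : IsPoissonPointProcess ν P := isPoissonPointProcess_poissonLaw ν hν0
  haveI := hP.isProbabilityMeasure
  -- the maps
  set T : PointConfig (V3 × V3) → (Fin 3 → Fin m) → PointConfig (V3 × V3) := fun ω j => ω.restrict (window (Λ j))
    with hTdef
  have hT : Measurable T := measurable_pi_lambda _ fun j => PointConfig.measurable_restrict (measurableSet_window (hΛm j))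
  have hTw : (fun (ω : PointConfig (V3 × V3)) (j : Fin 3 → Fin m) => windowRestrict (c9Cell ε⁻¹ m j) ω) = T := by
    funext ω j
    simp only [hTdef, hΛdef, windowRestrict, window, Set.prod_univ]
  set bN : Config (N + 1) (Fin 3) T3 → (Fin (N + 1) → V3 × V3) := fun w i => blowUpPoint ε x₀ (w i) with hbNdef
  have hbN : Measurable bN := measurable_pi_lambda _ fun i => (measurable_blowUpPoint ε x₀).comp (measurable_pi_apply i)
  have hB : (blowUp ε x₀ : Config (N + 1) (Fin 3) T3 → PointConfig (V3 × V3)) = PointConfig.ofFn ∘ bN :=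
    funext fun w => rfl
  have hofFn : Measurable (PointConfig.ofFn : (Fin (N + 1) → V3 × V3) → PointConfig (V3 × V3)) :=
    PointConfig.measurable_ofFn (N + 1)
  -- the events
  set Dhc : Set (Fin (N + 1) → V3 × V3) := {y | ∀ i i', i ≠ i' → 1 ≤ c9PerSqDist ε⁻¹ (y i).1 (y i').1} with hDhcdef
  have hDhc : MeasurableSet Dhc := by
    have h : Dhc = ⋂ i, ⋂ i', ⋂ (_ : i ≠ i'), (fun y : Fin (N + 1) → V3 × V3 => (y i, y i')) ⁻¹'
        {pq | 1 ≤ c9PerSqDist ε⁻¹ pq.1.1 pq.2.1} := by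
      ext y; simp [hDhcdef]
    rw [h]
    exact MeasurableSet.iInter fun i => MeasurableSet.iInter fun i' => MeasurableSet.iInter fun _ =>
      (measurableSet_le measurable_const (measurable_c9PerSqDist ε⁻¹)).preimage
        ((measurable_pi_apply i).prodMk (measurable_pi_apply i'))
  set E : Set ((Fin 3 → Fin m) → PointConfig (V3 × V3)) := c9TorusHardCoreTuples ε⁻¹ m (N + 1) with hEdef
  have hE : MeasurableSet E := measurableSet_c9TorusHardCoreTuples ε⁻¹ m (N + 1)
  have hEH : E ⊆ Set.pi univ fun _ => hardCoreSet 1 := fun t ht j _ p hp q hq hpq => by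
    rw [dist_eq_norm, ← one_le_sq_iff₀ (norm_nonneg _)]
    exact (ht.2 j j p q hp hq (Or.inr hpq)).trans (c9PerSqDist_le_norm_sq hS.le _ _)
  set piU : Measure (Fin (N + 1) → V3 × V3) := Measure.pi fun _ => mU with hpiU
  -- almost surely the positions are covered by the cells
  have haeU : ∀ᵐ y ∂piU, ∀ i, (y i).1 ∈ U := by
    rw [ae_all_iff]
    intro i
    have h1 : ∀ᵐ p ∂mU, p.1 ∈ U := by
      rw [ae_iff, hmUdef, show {p : V3 × V3 | ¬ p.1 ∈ U} = Uᶜ ×ˢ univ from Set.ext fun p => by simp, Measure.prod_prod,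
        Measure.restrict_apply hUm.compl, compl_inter_self, measure_empty, zero_mul]
    exact (Measure.tendsto_eval_ae_ae (μ := fun _ => mU) (i := i)).eventually h1
  have haeP : ∀ᵐ ω ∂P, ∀ p ∈ ω, p.1 ∈ U := by
    have hPU : P = (poissonLaw ν).map (PointConfig.restrict (window U)) := by
      rw [poissonLaw_map_restrict ν hν0 (measurableSet_window hUm), hνdef, hmUdef, Measure.restrict_smul, window,
        ← Measure.restrict_prod_eq_prod_univ, Measure.restrict_restrict hUm, Set.inter_self]
    rw [hPU]
    filter_upwards [ae_map_restrict_carrier_subset (measurableSet_window hUm) (poissonLaw ν)] with ω hω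
    exact fun p hp => mem_window.1 (hω hp)
  -- (1) the left side: the conditioned ideal gas, blown up
  have hDpos : {w : Config (N + 1) (Fin 3) T3 | (fun i => (w i).1) ∈
      Literature.MathematicalPhysics.StatisticalMechanics.hardCoreSet (Ov ε) (Finset.univ : Finset (Fin (N + 1)))} =
        bN ⁻¹' Dhc := by
    ext w
    simp only [Literature.MathematicalPhysics.StatisticalMechanics.hardCoreSet, Ov, Finset.mem_univ, true_implies,
      mem_setOf_eq, mem_preimage, hDhcdef, hbNdef, blowUpPoint, not_lt]
    exact forall₂_congr fun i i' => imp_congr_right fun _ => le_euclidDist_iff_one_le_c9PerSqDist hε x₀ _ _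
  have hpibN : (Measure.pi fun _ : Fin (N + 1) => (volume : Measure T3).prod M).map bN =
      ENNReal.ofReal (ε ^ 3) ^ (N + 1) • piU := by
    rw [Measure.pi_map_pi fun _ => (measurable_blowUpPoint ε x₀).aemeasurable]
    simp only [hMdef, map_blowUpPoint_eq hε x₀, smul_symCube_eq_iUnion_c9Cell hε hm]
    rw [show (fun _ : Fin (N + 1) => ENNReal.ofReal (ε ^ 3) • mU) = fun _ => Real.toNNReal (ε ^ 3) • mU from rfl,
      Literature.Analysis.FunctionSpaces.Measure.pi_const_smul, Fintype.card_fin]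
    rfl
  have hL : ((localGibbsLaw σ (fun _ => a) (fun _ => u₀) (fun _ => θ) N Φ).map (blowUp ε x₀)).map T =
      (piU[|Dhc]).map (T ∘ PointConfig.ofFn) := by
    rw [hG, hDpos, hB, ← Measure.map_map hofFn hbN, ← cond_map_eq_map_cond hbN _ hDhc, hpibN,
      cond_smul_measure _ (pow_ne_zero _ (ENNReal.ofReal_pos.2 (pow_pos hε 3)).ne')
        (ENNReal.pow_ne_top ENNReal.ofReal_ne_top), Measure.map_map hT hofFn]
  -- (2) the right side: the conditioned Poisson product
  have hγ : (fun j : Fin 3 → Fin m => gibbsSpecMeasure 1 z θ⁻¹ u₀ (c9Cell ε⁻¹ m j) ∅) =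
      fun j => (P.map (PointConfig.restrict (window (Λ j))))[|hardCoreSet 1] := by
    funext j
    rw [gibbsSpecMeasure_empty_eq_cond_poissonLaw hz hθ u₀ (hΛm j) (hUb.subset (subset_iUnion Λ j)), hPdef,
      poissonLaw_map_restrict ν hν0 (measurableSet_window (hΛm j)), hνdef, Measure.restrict_smul, hmUdef, window,
      ← Measure.restrict_prod_eq_prod_univ, Measure.restrict_restrict (hΛm j), Set.inter_eq_left.2 (subset_iUnion Λ j)]
  have hTE : T ⁻¹' E =ᵐ[P] (T ⁻¹' E ∩ {c | c.count univ = ((N + 1 : ℕ) : ℕ∞)} : Set (PointConfig (V3 × V3))) := by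
    refine Filter.eventuallyEq_set.2 (haeP.mono fun ω hω => ⟨fun h => ⟨h, ?_⟩, fun h => h.1⟩)
    exact ((cellTuple_mem_c9TorusHardCoreTuples_iff hS hm (N + 1) fun p hp => mem_iUnion.1 (hω p hp)).1 h).1
  have hc0 : ENNReal.ofReal (Real.exp (-(ν univ).toReal)) * (((N + 1).factorial : ℝ≥0∞))⁻¹ ≠ 0 :=
    mul_ne_zero (ENNReal.ofReal_pos.2 (Real.exp_pos _)).ne' (ENNReal.inv_ne_zero.2 (ENNReal.natCast_ne_top _))
  have hctop : ENNReal.ofReal (Real.exp (-(ν univ).toReal)) * (((N + 1).factorial : ℝ≥0∞))⁻¹ ≠ ∞ :=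
    ENNReal.mul_ne_top ENNReal.ofReal_ne_top (ENNReal.inv_ne_top.2 (by exact_mod_cast (Nat.factorial_pos _).ne'))
  have hz0 : ((Real.toNNReal z : ℝ≥0∞)) ^ Fintype.card (Fin (N + 1)) ≠ 0 :=
    pow_ne_zero _ (ENNReal.coe_ne_zero.2 (Real.toNNReal_pos.2 hz).ne')
  have hR : (Measure.pi fun j : Fin 3 → Fin m => gibbsSpecMeasure 1 z θ⁻¹ u₀ (c9Cell ε⁻¹ m j) ∅)[|E] =
      (piU[|(T ∘ PointConfig.ofFn) ⁻¹' E]).map (T ∘ PointConfig.ofFn) := by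
    rw [hγ, pi_cond_eq_cond_pi _ fun _ => measurableSet_hardCoreSet 1,
      ← map_pi_restrict_eq_pi_of_poisson hP (fun j => measurableSet_window (hΛm j)) hdisjW,
      cond_cond_eq_cond_inter' (MeasurableSet.univ_pi fun _ => measurableSet_hardCoreSet 1) hE (measure_ne_top _ _),
      Set.inter_eq_right.2 hEH, cond_map_eq_map_cond hT _ hE, cond_congr_ae P hTE,
      cond_inter_eq_cond_restrict P (hE.preimage hT), restrict_count_eq_smul_map_ofFn_of_poisson hP hν0 (N + 1),
      cond_smul_measure _ hc0 hctop, hνdef, Literature.Analysis.FunctionSpaces.Measure.pi_const_smul, Measure.map_smul,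
      cond_smul_measure _ hz0 (ENNReal.pow_ne_top ENNReal.coe_ne_top), cond_map_eq_map_cond hofFn _ (hE.preimage hT),
      Measure.map_map hT hofFn]
    rfl
  -- (3) the two conditioning events agree almost surely
  have hDE : Dhc =ᵐ[piU] (T ∘ PointConfig.ofFn) ⁻¹' E := by
    refine Filter.eventuallyEq_set.2 (haeU.mono fun y hy => ?_)
    have hcov : ∀ p ∈ PointConfig.ofFn y, ∃ j, p.1 ∈ c9Cell ε⁻¹ m j := fun p hp => by
      obtain ⟨i, rfl⟩ := PointConfig.mem_ofFn.1 hp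
      exact mem_iUnion.1 (hy i)
    exact ((ofFn_count_and_forall_iff hS.le y).symm.trans
      (cellTuple_mem_c9TorusHardCoreTuples_iff hS hm (N + 1) hcov).symm)
  rw [hTw, hL, hR, cond_congr_ae piU hDE]

end Summit.AtomisticToContinuum.HydrodynamicLimit.Theorems.KiferCompactification

end
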